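import Literature.MathematicalPhysics.QuantumFieldTheory.Balaban1983to89.B9Thm311DeltaAGaugeOrbit
import Literature.MathematicalPhysics.QuantumFieldTheory.Balaban1983to89.B9Thm311PosOfPrincipalAtLettersY
import Literature.Analysis.InnerProduct.PositiveDefiniteStability

/-!
# `Balaban1983to89.B9Thm311CoercivePureGaugeAtLettersY` — [B9] Theorem 3.11's gauge-fixed operator `Δ_a(U)` and its PRINCIPAL FORM (3.26) are
# COERCIVE, with ONE constant per member UNIFORM ON THE GAUGE ORBIT OF `1`, at def-Y's v4 letters (`parSymY`, `parBY`, `G′ = GpY parSymY`)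

T. Bałaban, *Propagators for lattice gauge theories in a background field*, Commun. Math. Phys. **99** (1985) 389–434
[`Balaban1985BackgroundPropagators`, "B9"]; [4] = T. Bałaban, *Propagators and renormalization transformations for lattice gauge theories. II*,
Commun. Math. Phys. **96** (1984) 223–250.

statement-level skeleton of published theorems with citation tags; proofs where landed; nothing here is a claim about the
Yang–Mills mass gap

THE PRINTED LOCI (verbatim).  p. 416, Theorem 3.11: *"… the operators Δ′_a, G′, (Q′G′²Q′\*)⁻¹, Δ_a, G are positive definite. … In [4] we have
proved that the operator G_□(1) is positive"*;  p. 395: *"It coincides with Δ_a in (2.19) [of [4]] if U = 1"*, (3.26) *"⟨A, Δ_a A⟩ = ⟨A, Δ(U)A⟩ +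
⟨D\*_U A, R(U) D\*_U A⟩ + ⟨Q(U)A, Q(U)A⟩_a"*;  p. 396, (3.34): *"Δ_a(U^u) = R(u) Δ_a(U) R(u⁻¹)"*;  p. 392, (3.10): Δ(U) = D\*_U 𝒦_U D_U + Δ′₂(U) with
the Jordan insertion `𝒦_U F(p) = ½(Re U(∂p)·F(p) + F(p)·Re U(∂p))` and the curvature operator Δ′₂(U) built on `c_f² Im U(∂p)` — both trivial when
every plaquette variable `U(∂p)` is `1`.

WHY THIS FILE (cell context).  Row 17 of the N06 certificate displays, at generic class parameters `(R₁, R₂)`, either the clause «Δ_a(U) is positive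
definite on R₁» (`B9Thm39Thm311AtLettersR.t311_of_pins_opsYOfLettersV4₁R`) or the PRINCIPAL COERCIVITY «γ(x)⟨A,A⟩₁ ≦ ‖D_UA‖² + ⟨D\*_UA, R(U)D\*_UA⟩₁ +
‖Q(U)A‖²_w on R₁» with a plaquette bound δ (`B9Thm311PrincipalAtLettersR.t311_of_pins_principalR`).  The director's STANDING A6 RULE (pub-ymgap №189 (3),
2026-08-27) asks every such face for a NAMED INHABITANT of its member-local binders.  The honest inhabitant the tree can supply is the class of PURE
GAUGES `U = 1^u` (print's «if U = 1», transported by (3.34)): there the clause is a theorem (`B9Thm311DeltaAGaugeOrbit.posDefTr_deltaAY_parSymY_pureGauge`,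
gen 10), and THIS FILE upgrades that qualitative positivity to the QUANTITATIVE binder the principal face displays — a coercivity constant `γ > 0` per
member, the SAME for every pure gauge, for the full form AND for the principal form (they coincide on flat backgrounds).  The sequel
`B9Thm311PureGaugeClassAtLettersR` feeds these into the two faces.

WHAT IS PROVED (sorry-free; 0 `def`).
* §0 (generic, weighted trace currency) `exists_pos_coer_of_posDefTr`: a positive definite operator on `𝔤`-valued lattice functions over a finite lattice is
  COERCIVE — `∃ γ > 0, γ⟨Φ,Φ⟩_w ≦ ⟨Φ, TΦ⟩_w` (the orthonormal coordinates `realify311` + the tree's finite-dimensional compactness lemma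
  `Literature.Analysis.InnerProduct.exists_pos_mul_norm_sq_le_of_pos`);  `coer_of_intw_conjY`: a coercivity constant TRANSPORTS along an
  `R(u)`-intertwining `T′R(u) = R(u)T` (unitary `u`; the isometry `trIP_one_conjY_conjY`) — the quantitative twin of gen 10's `posDefTr_of_intw_conjY`.
* §1 (flat backgrounds, any `𝔸`) under `∀ p, U(∂p) = 1`: `reHolY_eq_one_of_flat`, `imHolY_eq_zero_of_flat`, `jordanY_eq_id_of_flat` (𝒦_U = id),
  `curv2Y_eq_zero_of_flat` (Δ′₂(U) = 0); at `𝔸 = M_N(ℂ)`, unitary-valued `U`: ★ `trIP_hessY_eq_curl_of_flat` (⟨A, Δ(U)A⟩₁ = ‖D_UA‖², (3.10)),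
  ★ `trIP_principal_eq_deltaAY_of_flat` (the principal gauge-fixed form IS ⟨A, Δ_a(U)A⟩₁, (3.26)).
* §2 (pure gauges) `holY_gaugeY_one` (`(1^u)(∂p) = 1`), `exists_coer_deltaAY_parSymY_one` (∃ γ > 0 at `U = 1`), ★★ `exists_coer_deltaAY_parSymY_pureGauge`
  (∃ γ > 0 per member with γ⟨A,A⟩₁ ≦ ⟨A, Δ_a(1^u)A⟩₁ for EVERY unitary-valued `u` — (3.34)), ★★ `exists_principal_coer_pureGauge` (the same γ bounds the
  principal form on the whole orbit — exactly the binder `hcoer` of `t311_of_pins_principalR` on the pure-gauge class, with δ = 0).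
HONEST SCOPE.  Finite-dimensional bookkeeping at the TRIVIAL orbit: `γ` is a per-member number (compactness), NOT print's volume-uniform constant of
Theorem 3.3 ∕ [4]; nothing is said about the class (3.35) of record; nothing of [B9] or [4] is asserted; NOT a node discharge, NOT summit progress;
count-neutral; one finite 𝕋⁴ programme — nothing continuum, nothing about the mass gap.  Cell `pub-ymgap` (HUMAN RULING D-0062), Track A node N06 [B9],
seat `pub-ymgap-dag-n06-j` (harness re-seat gen 13), 2026-08-27.  No `sorry`, no `axiom`, no `instance`, no `notation`, no `def`.
-/

namespace Literature.MathematicalPhysics.QuantumFieldTheory.Balaban1983to89.B9Thm311CoercivePureGaugeAtLettersY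

open Literature.MathematicalPhysics.QuantumFieldTheory.Balaban1983to89
open B9Thm311ReadingCoords B9Thm311AdjointAtLetters B9Thm311DeltaPrimeSymm B9Thm311DeltaPrimePos B9Thm311AdjointPairs B9Thm311Curv2Symm
  B9Thm311ProjectionR B9Thm311PosAtRecordV4 B9Thm311DeltaAGaugeOrbit B9Thm311PosOfPrincipalAtLettersY Node00
open B6KLevelCensusIndexV1 B9BackgroundsKLevelV1 B6GlobalChartV1
open scoped Matrix

noncomputable section

/-! ## §0 Generic: positive definite ⟹ coercive (finite lattice); coercivity transports along `R(u)`-intertwinings -/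

section Generic

variable {S n : Type} [Fintype S] [Fintype n]

/-- **POSITIVE DEFINITE ⟹ COERCIVE on a finite lattice** (weighted real trace currency): if `⟨Φ, TΦ⟩_w > 0` for every `Φ ≠ 0` then
`∃ γ > 0, γ⟨Φ,Φ⟩_w ≦ ⟨Φ, TΦ⟩_w` — the minimum of the quadratic form over the compact unit sphere of the orthonormal coordinate picture `realify311`.
[cite: Balaban1985BackgroundPropagators, Thm 3.11 p.416 («positive definite»), p.393 (scalar products); folklore (finite-dimensional compactness)] -/
theorem exists_pos_coer_of_posDefTr {w : S → ℝ} (hw : ∀ s, 0 < w s) {T : (S → Matrix n n ℂ) →ₗ[ℂ] (S → Matrix n n ℂ)} (hT : PosDefTr w T) :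
    ∃ γ : ℝ, 0 < γ ∧ ∀ Φ : S → Matrix n n ℂ, γ * trIP w Φ Φ ≤ trIP w Φ (T Φ) := by
  classical
  set e := realify311 w hw with he
  set T' : EuclideanSpace ℝ (Idx311 S n) →ₗ[ℝ] EuclideanSpace ℝ (Idx311 S n) := conj311 e e T with hT'
  set Tc : EuclideanSpace ℝ (Idx311 S n) →L[ℝ] EuclideanSpace ℝ (Idx311 S n) := LinearMap.toContinuousLinearMap T' with hTc
  set g : EuclideanSpace ℝ (Idx311 S n) →L[ℝ] EuclideanSpace ℝ (Idx311 S n) →L[ℝ] ℝ :=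
    (innerSL ℝ).bilinearComp (ContinuousLinearMap.id ℝ _) Tc with hg
  have hgap : ∀ v u, g v u = inner ℝ v (T' u) := fun v u => by
    simp [hg, hTc]
  have hpos : ∀ v, v ≠ 0 → 0 < g v v := fun v hv => by
    rw [hgap]
    exact (posDef_conj311_realify311_iff (w := w) (hw := hw) T).mpr hT v hv
  obtain ⟨lam, hlam, hle⟩ := Literature.Analysis.InnerProduct.exists_pos_mul_norm_sq_le_of_pos g hpos
  refine ⟨lam, hlam, fun Φ => ?_⟩
  have h1 : ‖e Φ‖ ^ 2 = trIP w Φ Φ := norm_sq_realify311 Φ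
  have h2 : g (e Φ) (e Φ) = trIP w Φ (T Φ) := by
    rw [hgap, hT', conj311_apply, LinearEquiv.symm_apply_apply, he, inner_realify311]
  have key := hle (e Φ)
  rwa [h1, h2] at key

open scoped Matrix.Norms.L2Operator in
/-- **A COERCIVITY CONSTANT TRANSPORTS ALONG AN `R(u)`-INTERTWINING** `T′R(u) = R(u)T` (unitary-valued `u`): `γ⟨Φ,Φ⟩₁ ≦ ⟨Φ, TΦ⟩₁` for all `Φ` implies
`γ⟨Ψ,Ψ⟩₁ ≦ ⟨Ψ, T′Ψ⟩₁` for all `Ψ` — (3.34) read quantitatively: `R(u)` is an isometry of the trace pairing and is onto.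
[cite: Balaban1985BackgroundPropagators, (3.34) p.396, p.393 (scalar products)] -/
theorem coer_of_intw_conjY {N : ℕ} {γ : S → (Matrix (Fin N) (Fin N) ℂ)ˣ}
    (hγ : ∀ s, ((γ s : (Matrix (Fin N) (Fin N) ℂ)ˣ) : Matrix (Fin N) (Fin N) ℂ) ∈ unitary _)
    {T T' : (S → Matrix (Fin N) (Fin N) ℂ) →ₗ[ℂ] (S → Matrix (Fin N) (Fin N) ℂ)} (h : Intw (conjY γ) (conjY γ) T T') {c : ℝ}
    (hT : ∀ Φ, c * trIP (fun _ => (1 : ℝ)) Φ Φ ≤ trIP (fun _ => (1 : ℝ)) Φ (T Φ)) (Ψ : S → Matrix (Fin N) (Fin N) ℂ) :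
    c * trIP (fun _ => (1 : ℝ)) Ψ Ψ ≤ trIP (fun _ => (1 : ℝ)) Ψ (T' Ψ) := by
  have h2 : conjY γ (conjY γ⁻¹ Ψ) = Ψ := by
    rw [← LinearMap.comp_apply, ← conjY_mul, mul_inv_cancel, conjY_one, LinearMap.id_apply]
  have key := hT (conjY γ⁻¹ Ψ)
  rw [← trIP_one_conjY_conjY γ hγ (conjY γ⁻¹ Ψ) (conjY γ⁻¹ Ψ), ← trIP_one_conjY_conjY γ hγ (conjY γ⁻¹ Ψ) (T (conjY γ⁻¹ Ψ)),
    ← h.apply, h2] at key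
  exact key

end Generic

/-! ## §1 Flat backgrounds: `𝒦_U = id`, `Δ′₂(U) = 0`, `⟨A, Δ(U)A⟩ = ‖D_UA‖²`, principal form = `⟨A, Δ_a(U)A⟩` -/

section Flat

variable {d ℓ : ℕ} {hd : 1 ≤ d + 1} {hL : Odd (ℓ + 1) ∧ 1 < ℓ + 1} {b₀ b₁ : ℝ}
variable (i : KIdx d ℓ hd hL b₀ b₁)
variable {𝔸 : Type} [NormedRing 𝔸] [NormedAlgebra ℂ 𝔸] [CompleteSpace 𝔸] {U : CfgY 𝔸 i}

/-- on a flat background `Re U(∂p) = 1`. [cite: Balaban1985BackgroundPropagators, (3.7) p.391, bookkeeping] -/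
theorem reHolY_eq_one_of_flat (hflat : ∀ p : PlaqY i, holY i U p = 1) (p : PlaqY i) : reHolY i U p = 1 := by
  rw [reHolY, hflat, inv_one, Units.val_one, ← two_smul ℂ (1 : 𝔸), smul_smul]
  norm_num

/-- on a flat background `Im U(∂p) = 0`. [cite: Balaban1985BackgroundPropagators, (3.7) p.391, bookkeeping] -/
theorem imHolY_eq_zero_of_flat (hflat : ∀ p : PlaqY i, holY i U p = 1) (p : PlaqY i) : imHolY i U p = 0 := by
  rw [imHolY, hflat, inv_one, Units.val_one, sub_self, smul_zero]

/-- on a flat background the Jordan insertion `𝒦_U` of (3.10) is the identity. [cite: Balaban1985BackgroundPropagators, (3.10) p.392] -/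
theorem jordanY_eq_id_of_flat (hflat : ∀ p : PlaqY i, holY i U p = 1) : jordanY i U = LinearMap.id := by
  refine LinearMap.ext fun F => funext fun p => ?_
  simp only [jordanY, LinearMap.smul_apply, Pi.smul_apply, LinearMap.pi_apply, LinearMap.comp_apply, LinearMap.proj_apply,
    LinearMap.add_apply, LinearMap.mulRight_apply, LinearMap.mulLeft_apply, reHolY_eq_one_of_flat i hflat, mul_one, one_mul,
    LinearMap.id_apply]
  rw [← two_smul ℂ (F p), smul_smul]
  norm_num

/-- **on a flat background the curvature operator `Δ′₂(U)` of (3.10) VANISHES** (it is built on `c_f² Im U(∂p) = 0`).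
[cite: Balaban1985BackgroundPropagators, (3.10) p.392] -/
theorem curv2Y_eq_zero_of_flat (hflat : ∀ p : PlaqY i, holY i U p = 1) : curv2Y i U = 0 := by
  refine LinearMap.ext fun A => funext fun b => ?_
  simp [curv2Y, imHolY_eq_zero_of_flat i hflat, commY_zero]

end Flat

section FlatForms

open scoped Matrix.Norms.L2Operator

variable {d ℓ : ℕ} {hd : 1 ≤ d + 1} {hL : Odd (ℓ + 1) ∧ 1 < ℓ + 1} {b₀ b₁ : ℝ} {N : ℕ}
variable (i : KIdx d ℓ hd hL b₀ b₁) {U : CfgY (Matrix (Fin N) (Fin N) ℂ) i}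

/-- ★ **ON A FLAT UNITARY BACKGROUND `⟨A, Δ(U)A⟩₁ = ‖D_U A‖²₁`** — (3.10) with `𝒦_U = id` and `Δ′₂(U) = 0` (`trIP_hessY_eq`).
[cite: Balaban1985BackgroundPropagators, (3.10) p.392, (3.9) p.392] -/
theorem trIP_hessY_eq_curl_of_flat
    (hU : ∀ μ x, ((U μ x : (Matrix (Fin N) (Fin N) ℂ)ˣ) : Matrix (Fin N) (Fin N) ℂ) ∈ unitary (Matrix (Fin N) (Fin N) ℂ))
    (hflat : ∀ p : PlaqY i, holY i U p = 1) (A : FBondY i → Matrix (Fin N) (Fin N) ℂ) :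
    trIP (fun _ => (1 : ℝ)) A (hessY i U A) = trIP (fun _ => (1 : ℝ)) (curlY i U A) (curlY i U A) := by
  rw [trIP_hessY_eq i hU A, jordanY_eq_id_of_flat i hflat, curv2Y_eq_zero_of_flat i hflat, LinearMap.id_apply, LinearMap.zero_apply,
    trIP_zero_right, add_zero]

variable {G : Subgroup (Matrix (Fin N) (Fin N) ℂ)ˣ}

/-- ★ **ON A FLAT `G`-VALUED BACKGROUND (`G ≤ U(N)`) THE PRINCIPAL GAUGE-FIXED FORM IS `⟨A, Δ_a(U)A⟩₁`**:
`‖D_UA‖²₁ + ⟨D*_UA, R(U)D*_UA⟩₁ + ‖Q(U)A‖²_w = ⟨A, Δ_a(U)A⟩₁` — (3.26) as forms (`trIP_deltaAY_parSymY_eq`) with `⟨A, Δ(U)A⟩₁ = ‖D_UA‖²₁`.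
[cite: Balaban1985BackgroundPropagators, (3.26) p.395, (3.10) p.392] -/
theorem trIP_principal_eq_deltaAY_of_flat (hG : G ≤ B7Prop2Explicit.unitaryUnits (Matrix (Fin N) (Fin N) ℂ)) (hU : ∀ μ x, U μ x ∈ G)
    (hflat : ∀ p : PlaqY i, holY i U p = 1) (A : FBondY i → Matrix (Fin N) (Fin N) ℂ) :
    trIP (fun _ => (1 : ℝ)) (curlY i U A) (curlY i U A)
        + trIP (fun _ => (1 : ℝ)) (divY i U A) (RY i (parSymY i) (GpY i (parSymY i)) U (divY i U A))
        + trIP i.w (QY i (parBY i) U A) (QY i (parBY i) U A)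
      = trIP (fun _ => (1 : ℝ)) A (deltaAY i (parSymY i) (parBY i) (GpY i (parSymY i)) U A) := by
  rw [trIP_deltaAY_parSymY_eq i hG hU A, trIP_hessY_eq_curl_of_flat i (fun μ x => hG (hU μ x)) hflat A]

end FlatForms

/-! ## §2 Pure gauges: `(1^u)(∂p) = 1`; one coercivity constant per member, uniform on the orbit of `1`, for `Δ_a` and for the principal form -/

section PureGauge

open scoped Matrix.Norms.L2Operator

variable {d ℓ : ℕ} {hd : 1 ≤ d + 1} {hL : Odd (ℓ + 1) ∧ 1 < ℓ + 1} {b₀ b₁ : ℝ} {N : ℕ}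
variable (i : KIdx d ℓ hd hL b₀ b₁)

/-- a pure gauge is FLAT: `(1^u)(∂p) = u(x)·1·u(x)⁻¹ = 1` (`holY_gaugeY`, `holY_one`). [cite: Balaban1985BackgroundPropagators, (3.28) p.395, (3.2) p.390] -/
theorem holY_gaugeY_one {𝔸 : Type} [NormedRing 𝔸] [NormedAlgebra ℂ 𝔸] [CompleteSpace 𝔸] (u : GaugeY 𝔸 i) (p : PlaqY i) :
    holY i (gaugeY i u (fun _ _ => 1)) p = 1 := by
  rw [holY_gaugeY, holY_one, mul_one, mul_inv_cancel]

/-- a pure gauge `1^u` with `u` valued in a subgroup `G` is `G`-valued: `(1^u)(⟨x, x+e_μ⟩) = u(x)·u(x+e_μ)⁻¹`.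
[cite: Balaban1985BackgroundPropagators, (3.28) p.395, bookkeeping] -/
theorem gaugeY_one_mem {𝔸 : Type} [NormedRing 𝔸] [NormedAlgebra ℂ 𝔸] [CompleteSpace 𝔸] {G : Subgroup 𝔸ˣ} {u : GaugeY 𝔸 i}
    (hu : ∀ x, u x ∈ G) (μ : Fin (d + 1)) (x : Site (PV d ℓ i.m i.K hd hL) 0) : gaugeY i u (fun _ _ => 1) μ x ∈ G := by
  rw [gaugeY_apply, mul_one]
  exact G.mul_mem (hu x) (G.inv_mem (hu _))

/-- **`Δ_a(1)` IS COERCIVE** (per member): `∃ γ > 0, γ⟨A,A⟩₁ ≦ ⟨A, Δ_a(1)A⟩₁` — gen 7's `posDefTr_deltaAY_parSymY_one` ([4]: `G(1)` positive) made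
quantitative by §0. [cite: Balaban1985BackgroundPropagators, Thm 3.11 p.416, p.395 («if U = 1»); Balaban1984PropagatorsII, p.228] -/
theorem exists_coer_deltaAY_parSymY_one :
    ∃ γ : ℝ, 0 < γ ∧ ∀ A : FBondY i → Matrix (Fin N) (Fin N) ℂ,
      γ * trIP (fun _ => (1 : ℝ)) A A
        ≤ trIP (fun _ => (1 : ℝ)) A (deltaAY i (parSymY i) (parBY i) (GpY i (parSymY i)) (fun _ _ => 1 : CfgY (Matrix (Fin N) (Fin N) ℂ) i) A) :=
  exists_pos_coer_of_posDefTr (fun _ => one_pos) (posDefTr_deltaAY_parSymY_one i)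

/-- ★★ **`Δ_a` IS COERCIVE ON THE WHOLE GAUGE ORBIT OF `1` WITH ONE CONSTANT** (per member): `∃ γ > 0, ∀ u` unitary-valued, `∀ A`,
`γ⟨A,A⟩₁ ≦ ⟨A, Δ_a(1^u)A⟩₁` — the `U = 1` constant transported by (3.34) (`deltaAY_cov` at def-Y's lawful letters, §0 `coer_of_intw_conjY`).
[cite: Balaban1985BackgroundPropagators, (3.34) p.396, Thm 3.11 p.416] -/
theorem exists_coer_deltaAY_parSymY_pureGauge :
    ∃ γ : ℝ, 0 < γ ∧ ∀ u : GaugeY (Matrix (Fin N) (Fin N) ℂ) i,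
      (∀ x, ((u x : (Matrix (Fin N) (Fin N) ℂ)ˣ) : Matrix (Fin N) (Fin N) ℂ) ∈ unitary _) →
        ∀ A : FBondY i → Matrix (Fin N) (Fin N) ℂ,
          γ * trIP (fun _ => (1 : ℝ)) A A
            ≤ trIP (fun _ => (1 : ℝ)) A (deltaAY i (parSymY i) (parBY i) (GpY i (parSymY i)) (gaugeY i u (fun _ _ => 1)) A) := by
  obtain ⟨γ, hγ, h1⟩ := exists_coer_deltaAY_parSymY_one (N := N) i
  exact ⟨γ, hγ, fun u hu A =>
    coer_of_intw_conjY (gBondY_mem_unitary i hu)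
      (deltaAY_cov (g := u) (U := (fun _ _ => 1 : CfgY (Matrix (Fin N) (Fin N) ℂ) i)) (parSymY_isGaugeLawS i) (parBY_isGaugeLawB i)
        (GpY_isCovSiteOpY (parSymY_isGaugeLawS i)))
      h1 A⟩

variable {G : Subgroup (Matrix (Fin N) (Fin N) ℂ)ˣ}

/-- ★★ **THE PRINCIPAL GAUGE-FIXED FORM IS COERCIVE ON THE PURE-GAUGE CLASS WITH ONE CONSTANT PER MEMBER**: for `G ≤ U(N)`,
`∃ γ > 0, ∀ u` `G`-valued, `∀ A`, `γ⟨A,A⟩₁ ≦ ‖D_UA‖²₁ + ⟨D*_UA, R(U)D*_UA⟩₁ + ‖Q(U)A‖²_w` at `U = 1^u` — §1 (flat: principal form = ⟨A, Δ_a(U)A⟩₁) and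
`exists_coer_deltaAY_parSymY_pureGauge`.  This is EXACTLY the binder `hcoer` of `B9Thm311PrincipalAtLettersR.t311_of_pins_principalR` on the class of pure
gauges (with δ = 0), inhabited. [cite: Balaban1985BackgroundPropagators, (3.26) p.395, (3.34) p.396, Thm 3.11 p.416] -/
theorem exists_principal_coer_pureGauge (hG : G ≤ B7Prop2Explicit.unitaryUnits (Matrix (Fin N) (Fin N) ℂ)) :
    ∃ γ : ℝ, 0 < γ ∧ ∀ u : GaugeY (Matrix (Fin N) (Fin N) ℂ) i, (∀ x, u x ∈ G) →
      ∀ A : FBondY i → Matrix (Fin N) (Fin N) ℂ,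
        γ * trIP (fun _ => (1 : ℝ)) A A
          ≤ trIP (fun _ => (1 : ℝ)) (curlY i (gaugeY i u (fun _ _ => 1)) A) (curlY i (gaugeY i u (fun _ _ => 1)) A)
            + trIP (fun _ => (1 : ℝ)) (divY i (gaugeY i u (fun _ _ => 1)) A)
                (RY i (parSymY i) (GpY i (parSymY i)) (gaugeY i u (fun _ _ => 1)) (divY i (gaugeY i u (fun _ _ => 1)) A))
            + trIP i.w (QY i (parBY i) (gaugeY i u (fun _ _ => 1)) A) (QY i (parBY i) (gaugeY i u (fun _ _ => 1)) A) := by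
  obtain ⟨γ, hγ, h⟩ := exists_coer_deltaAY_parSymY_pureGauge (N := N) i
  refine ⟨γ, hγ, fun u hu A => ?_⟩
  rw [trIP_principal_eq_deltaAY_of_flat i hG (gaugeY_one_mem i hu) (holY_gaugeY_one i u) A]
  exact h u (fun x => hG (hu x)) A

end PureGauge

end

end Literature.MathematicalPhysics.QuantumFieldTheory.Balaban1983to89.B9Thm311CoercivePureGaugeAtLettersY
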